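import Mathlib
import HarnessLib
import Summits.NavierStokesRegularity.NavierStokesRegularity.Theorems.TaylorModelRungThreeCertificateBoxFieldDStepMF
import Summits.NavierStokesRegularity.NavierStokesRegularity.Theorems.TaylorModelRungThreeSoundnessVectorTests

/-!
# Crux K1b-DR (stmt-NavierStokesRegularity-23954), line `taylor-model` — the SUB-STEP CORE of the v3 checker: boxes, interval tests and
# jet enclosures for the six sub-step conjuncts of `ChainVCore` (`…TaylorModelRungThreeVDefs` p620175), part 1 — definitions and the
# generic test lemmas (engine-1 g67's ask 09:45Z; PROPAGATE-V-SPEC-cert1 §2 B/C/G)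

ONE ATTEMPT of the sub-step core, `T.coreStep ci : CoreOut` (inputs `CoreIn`: coefficient boxes `coefB`, monomial table `mt`, `prec`,
orders `p`/`pV`, the outer start-hull box `H2`, the exact step `h : Dyad`, per-coordinate boxes `κωB ∋ κ·ω_k`, `ωB ∋ ω_k`, `ωinvB ∋ ω_k⁻¹`,
the Lipschitz trial `L1 : Dyad`, the box-inflation exponent `infl`): (1) interval jets of `H2` to order `p` and the Horner RANGE of the Taylor
polynomial over `u ∈ [0,h]`; (2) the a-priori STATE box `B` := that range inflated (CHOSEN — no claim); (3) the κ-difference box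
`BK := ±⌈L1′·κωB.hi⌉` and the variation box `BV := ±⌈L1′·ωB.hi⌉` (chosen, `L1′` slightly below `L1`); the tube boxes `B ⊕ BK`, `B ⊕ 2BK`;
(4) `J := mag` of the order-`p+1` jets over the tube box; (5) the STRICT high-order rough-enclosure TEST (E2); (6) the first-order
difference / variational TESTS (D1κ)/(V1) in ns-tm-g4's endpoint form from `G ∋ Qb y d + Qb d y + Qb d d` (linearised twin `linSym` at the
tube box + `qBboxMA BK BK`) and `G′ ∋ Qb y v + Qb v y`, with the box facts and the row bounds `≤ ⌊L1·κωB.lo⌋`, `≤ ⌊L1·ωB.lo⌋`;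
(7) `JU := mag` of the order-`pV+1` vector variational levels over `(B ⊕ 2BK) × BV`; (8) the signed derivative matrix `stepMatrixMF` over
`H2`. This part: the record types, the builders, the Boolean tests `testE2`/`testK`/`testV` with their REAL soundness lemmas
(`testE2_sound`, `testK_sound`, `testV_sound`) over arbitrary input arrays, and `coreStep` itself. Part 2 (`…CoreStepSound`) proves
`coreStep_sound`: `ok = true` ⇒ the six conjuncts verbatim.

MODEL-lattice bookkeeping only (rung TL-M3); nothing here concerns the Navier–Stokes equations.
-/

-- the sub-problem namespace repeats the summit name by design (D-0017)
set_option linter.dupNamespace false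

namespace Summit.NavierStokesRegularity.NavierStokesRegularity.Theorems.TaylorModelCert

open scoped BigOperators
open Set
open Literature.Analysis.FluidPDE.TaoCascade Literature.Analysis.FluidPDE.TaoCascade.TaylorChain
open Summit.NavierStokesRegularity.NavierStokesRegularity.Theorems.TaylorModelVector (mul_mem_Icc_min_max)

namespace IntervalD

/-! ### Chosen-object builders (no claims) -/

/-- Width `hi − lo` (exact). [folklore] -/
def width (I : IntervalD) : Dyad := Dyad.sub I.hi I.lo

/-- A box INFLATED by `mag·2^-infl + width·2^-8` on both sides, rounded outward (a CHOSEN object: no claim). [folklore] -/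
def inflate (prec infl : ℕ) (I : IntervalD) : IntervalD :=
  let δ := Dyad.add (Dyad.shift (mag I) (-(infl : ℤ))) (Dyad.shift (Dyad.abs (width I)) (-8))
  ⟨Dyad.roundDown prec (Dyad.sub I.lo δ), Dyad.roundUp prec (Dyad.add I.hi δ)⟩

/-- The symmetric box `[−r, r]`. [folklore] -/
def symBox (r : Dyad) : IntervalD := ⟨Dyad.neg r, r⟩

/-- Membership in a symmetric box from an absolute bound. [folklore] -/
theorem mem_symBox {x : ℝ} {r : Dyad} (h : |x| ≤ r.toReal) : mem x (symBox r) := by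
  simp only [mem, symBox, Dyad.toReal_neg]; constructor <;> linarith [neg_abs_le x, le_abs_self x]

/-- The real lower ends of an array of boxes, as a coordinate function. [folklore] -/
noncomputable def loR (X : Array IntervalD) (c : ℕ) : ℝ := (aget X c).lo.toReal

/-- The real upper ends of an array of boxes, as a coordinate function. [folklore] -/
noncomputable def hiR (X : Array IntervalD) (c : ℕ) : ℝ := (aget X c).hi.toReal

/-- Between the ends ⇒ member. [folklore] -/
theorem mem_of_loR_hiR {X : Array IntervalD} {c : ℕ} {x : ℝ} (h1 : loR X c ≤ x) (h2 : x ≤ hiR X c) : mem x (aget X c) := ⟨h1, h2⟩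

/-! ### (E2) the strict high-order rough-enclosure test -/

/-- (E2) TEST per coordinate `c < n`: `B.lo < P.lo − (J·Hp).hi` and `P.hi + (J·Hp).hi < B.hi`, where `P ∋` the Taylor polynomial over
`u ∈ [0,h]`, `J ≥ |jet_{p+1}|` over the tube and `Hp ∋ u^(p+1)`. [folklore] -/
def testE2 (n prec : ℕ) (B P : Array IntervalD) (J : Array Dyad) (Hp : IntervalD) : Bool :=
  allN n fun c =>
    let R := mulR prec (ofDyad (dget J c)) Hp
    Dyad.blt (aget B c).lo (Dyad.sub (aget P c).lo R.hi) && Dyad.blt (Dyad.add (aget P c).hi R.hi) (aget B c).hi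

/-- **Soundness of the (E2) test**: for every coordinate `c < n`, every `poly ∈ P[c]` and every `t ∈ Hp` (e.g. `t = u^(p+1)`):
`B[c].lo < poly − J[c]·t` and `poly + J[c]·t < B[c].hi`. [folklore] -/
theorem testE2_sound {n prec : ℕ} {B P : Array IntervalD} {J : Array Dyad} {Hp : IntervalD} (h : testE2 n prec B P J Hp = true)
    {c : ℕ} (hc : c < n) {poly t : ℝ} (hpoly : mem poly (aget P c)) (ht : mem t Hp) :
    loR B c < poly - (dget J c).toReal * t ∧ poly + (dget J c).toReal * t < hiR B c := by
  have hcR := (allN_eq_true.1 h) c hc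
  simp only [Bool.and_eq_true, Dyad.blt_iff, Dyad.toReal_sub, Dyad.toReal_add] at hcR
  have hR := (mem_mulR prec (mem_ofDyad (dget J c)) ht).2
  exact ⟨by unfold loR; linarith [hcR.1, hpoly.1], by unfold hiR; linarith [hcR.2, hpoly.2]⟩

/-! ### (D1κ)/(V1) the first-order tests, box facts and row bounds -/

/-- (D1κ)/(V1) TEST per coordinate `c < n` for a symmetric box `±hk[c]`, a centre bound box `cw[c]` (`∋ κ·ω` resp. `ω`), the field range
`G[c]` and the row factor `L1`: `0 ≤ L1`, `0 ≤ cw.lo`, `cw.hi ≤ hk`, `hk ≤ ⌊L1·cw.lo⌋`, `cw.hi + max 0 ⌈h·G.hi⌉ ≤ hk`,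
`−hk ≤ −cw.hi + min 0 ⌊h·G.lo⌋`. [folklore] -/
def testK (n prec : ℕ) (L1 h : Dyad) (cw : Array IntervalD) (hk : Array Dyad) (G : Array IntervalD) : Bool :=
  Dyad.ble (Dyad.ofInt 0) L1 && allN n fun c =>
    let w := aget cw c
    let r := dget hk c
    let g := aget G c
    Dyad.ble (Dyad.ofInt 0) w.lo && Dyad.ble w.hi r && Dyad.ble r (Dyad.roundDown prec (Dyad.mul L1 w.lo)) &&
      Dyad.ble (Dyad.add w.hi (Dyad.max (Dyad.ofInt 0) (Dyad.roundUp prec (Dyad.mul h g.hi)))) r &&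
      Dyad.ble (Dyad.neg r) (Dyad.add (Dyad.neg w.hi) (Dyad.min (Dyad.ofInt 0) (Dyad.roundDown prec (Dyad.mul h g.lo))))

/-- **Soundness of the (D1κ)/(V1) test** at a coordinate `c < n`, for the true centre radius `w ∈ cw[c]` (e.g. `κ·ω_k`): the box facts
`−hk ≤ 0 ≤ hk`, `−hk ≤ −w`, `w ≤ hk`; the row bound `max |−hk| |hk| ≤ L1·w`; and the endpoint inequalities
`−hk ≤ x₀ + min 0 (h·glo)`, `x₀ + max 0 (h·ghi) ≤ hk` for every `|x₀| ≤ w` and the real ends `glo, ghi` of `G[c]`. [folklore] -/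
theorem testK_sound {n prec : ℕ} {L1 h : Dyad} {cw : Array IntervalD} {hk : Array Dyad} {G : Array IntervalD}
    (ht : testK n prec L1 h cw hk G = true) {c : ℕ} (hc : c < n) {w : ℝ} (hw : mem w (aget cw c)) :
    (-(dget hk c).toReal ≤ 0 ∧ 0 ≤ (dget hk c).toReal ∧ -(dget hk c).toReal ≤ -w ∧ w ≤ (dget hk c).toReal) ∧
    max |-(dget hk c).toReal| |(dget hk c).toReal| ≤ L1.toReal * w ∧
    (∀ x₀ : ℝ, |x₀| ≤ w →
      -(dget hk c).toReal ≤ x₀ + min 0 (h.toReal * (aget G c).lo.toReal) ∧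
        x₀ + max 0 (h.toReal * (aget G c).hi.toReal) ≤ (dget hk c).toReal) := by
  simp only [testK, Bool.and_eq_true, allN_eq_true] at ht
  obtain ⟨hL1, hall⟩ := ht
  have hcR := hall c hc
  simp only [Dyad.ble_iff, Dyad.toReal_ofInt, Int.cast_zero, Dyad.toReal_add, Dyad.toReal_neg, Dyad.toReal_max,
    Dyad.toReal_min] at hcR hL1
  obtain ⟨⟨⟨⟨h0, h1⟩, h2⟩, h3⟩, h4⟩ := hcR
  have hwlo := hw.1
  have hwhi := hw.2
  have hrd : (Dyad.roundDown prec (Dyad.mul L1 (aget cw c).lo)).toReal ≤ L1.toReal * w := by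
    refine (Dyad.roundDown_le prec _).trans ?_
    rw [Dyad.toReal_mul]; exact mul_le_mul_of_nonneg_left hwlo hL1
  have hup : h.toReal * (aget G c).hi.toReal ≤ (Dyad.roundUp prec (Dyad.mul h (aget G c).hi)).toReal := by
    rw [← Dyad.toReal_mul]; exact Dyad.le_roundUp prec _
  have hdn : (Dyad.roundDown prec (Dyad.mul h (aget G c).lo)).toReal ≤ h.toReal * (aget G c).lo.toReal := by
    rw [← Dyad.toReal_mul]; exact Dyad.roundDown_le prec _
  have hr0 : 0 ≤ (dget hk c).toReal := h0.trans (hwlo.trans (hwhi.trans h1))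
  refine ⟨⟨by linarith, hr0, by linarith, hwhi.trans h1⟩, ?_, fun x₀ hx₀ => ⟨?_, ?_⟩⟩
  · rw [abs_neg, max_self, abs_of_nonneg hr0]; exact h2.trans hrd
  · have hx := (abs_le.1 hx₀).1
    have hmin : min 0 (Dyad.roundDown prec (Dyad.mul h (aget G c).lo)).toReal ≤ min 0 (h.toReal * (aget G c).lo.toReal) :=
      min_le_min le_rfl hdn
    linarith
  · have hx := (abs_le.1 hx₀).2
    have hmax : max 0 (h.toReal * (aget G c).hi.toReal) ≤ max 0 (Dyad.roundUp prec (Dyad.mul h (aget G c).hi)).toReal :=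
      max_le_max le_rfl hup
    linarith

/-- **The endpoint form gives the first-order box invariance** (ns-tm-g4's `mul_mem_Icc_min_max`): for `u ∈ [0,h]`, `g ∈ G[c]`,
`|x₀| ≤ w` as in `testK_sound`: `x₀ + u·g ∈ [−hk, hk]`. [folklore] -/
theorem mem_symBox_of_testK {n prec : ℕ} {L1 h : Dyad} {cw : Array IntervalD} {hk : Array Dyad} {G : Array IntervalD}
    (ht : testK n prec L1 h cw hk G = true) {c : ℕ} (hc : c < n) {w : ℝ} (hw : mem w (aget cw c)) {x₀ : ℝ} (hx₀ : |x₀| ≤ w)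
    {u : ℝ} (hu : u ∈ Icc 0 h.toReal) {g : ℝ} (hg : mem g (aget G c)) :
    -(dget hk c).toReal ≤ x₀ + u * g ∧ x₀ + u * g ≤ (dget hk c).toReal := by
  obtain ⟨-, -, hend⟩ := testK_sound ht hc hw
  obtain ⟨h1, h2⟩ := hend x₀ hx₀
  have hm := mul_mem_Icc_min_max hu hg
  exact ⟨by linarith [hm.1], by linarith [hm.2]⟩

end IntervalD

/-! ### The core: inputs, outputs, one attempt -/

/-- Inputs of one sub-step core attempt. [folklore] -/
structure CoreIn where
  /-- coefficient boxes (sound for the real coefficients, `CertTables.CoefBoxOK`) -/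
  coefB : Fin 4 → Fin 4 → Fin 4 → ℕ → ℤ → IntervalD
  /-- the active-monomial table (`= T.monosTable coefB`, computed once) -/
  mt : Array (List (ℕ × ℕ × ℕ))
  /-- rounding precision, Taylor order, variational order, box-inflation exponent -/
  (prec p pV infl : ℕ)
  /-- outer start-hull box `H²` (size `n`) -/
  H2 : Array IntervalD
  /-- exact step size -/
  h : Dyad
  /-- per-coordinate enclosures of `κ·ω_k`, `ω_k`, `ω_k⁻¹` (size `n`) -/
  (κωB ωB ωinvB : Array IntervalD)
  /-- the Lipschitz row factor (trial; `≥ 1`) -/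
  L1 : Dyad

/-- Outputs of one sub-step core attempt: verdict, the boxes (dyadic ends, size `n`), the jet magnitudes, the signed derivative matrix,
the row factor. [folklore] -/
structure CoreOut where
  ok : Bool
  (lo hi loK hiK loV hiV J JU : Array Dyad)
  M : Array (Array IntervalD)
  L1 : Dyad

namespace CertTables

variable {K : Type} [Field K] [LinearOrder K]

/-- **ONE ATTEMPT of the sub-step core** (see the module docstring for the recipe). [folklore] -/
def coreStep (T : CertTables K) (ci : CoreIn) : CoreOut :=
  let n := T.n
  let QBA := T.qBboxMA ci.coefB ci.prec ci.mt
  let Uh : IntervalD := ⟨Dyad.ofInt 0, ci.h⟩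
  -- jets of the hull and the Taylor-polynomial range over `u ∈ [0,h]`
  let LsH := IntervalD.jetLevelsA n QBA ci.prec ci.H2 ci.p
  let P := IntervalD.polyLevelsA n ci.prec LsH ci.p Uh
  -- chosen boxes
  let B : Array IntervalD := Array.ofFn fun c : Fin n => IntervalD.inflate ci.prec ci.infl (IntervalD.aget P c)
  let L1q := Dyad.sub ci.L1 (Dyad.shift ci.L1 (-12))
  let hK : Array Dyad := Array.ofFn fun c : Fin n => Dyad.roundUp ci.prec (Dyad.mul L1q (IntervalD.aget ci.κωB c).hi)
  let hV : Array Dyad := Array.ofFn fun c : Fin n => Dyad.roundUp ci.prec (Dyad.mul L1q (IntervalD.aget ci.ωB c).hi)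
  let BK : Array IntervalD := Array.ofFn fun c : Fin n => IntervalD.symBox (dget hK c)
  let BV : Array IntervalD := Array.ofFn fun c : Fin n => IntervalD.symBox (dget hV c)
  let TB : Array IntervalD := Array.ofFn fun c : Fin n => IntervalD.add (IntervalD.aget B c) (IntervalD.aget BK c)
  let TB2 : Array IntervalD := Array.ofFn fun c : Fin n => IntervalD.add (IntervalD.aget TB c) (IntervalD.aget BK c)
  -- (J) over the tube box
  let LsT := IntervalD.jetLevelsA n QBA ci.prec TB (ci.p + 1)
  let J : Array Dyad := Array.ofFn fun c : Fin n => IntervalD.mag (IntervalD.aget (IntervalD.lget LsT (ci.p + 1)) c)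
  -- (E2)
  let okE := IntervalD.testE2 n ci.prec B P J (IntervalD.powR ci.prec Uh (ci.p + 1))
  -- (D1κ)
  let G : Array IntervalD := Array.ofFn fun c : Fin n =>
    IntervalD.addR ci.prec (IntervalD.aget (IntervalD.applyLinF n ci.prec (T.linSym ci.coefB ci.prec ci.mt TB) BK) c)
      (IntervalD.aget (QBA BK BK) c)
  let okK := IntervalD.testK n ci.prec ci.L1 ci.h ci.κωB hK G
  -- (V1)
  let G' : Array IntervalD := IntervalD.applyLinF n ci.prec (T.linSym ci.coefB ci.prec ci.mt TB2) BV
  let okV := IntervalD.testK n ci.prec ci.L1 ci.h ci.ωB hV G'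
  -- (JU) over the doubled tube × BV
  let LsT2 := IntervalD.jetLevelsA n QBA ci.prec TB2 (ci.pV + 1)
  let UV := IntervalD.wColLevelsF n ci.prec (IntervalD.opsOf (T.linSym ci.coefB ci.prec ci.mt) LsT2 (ci.pV + 1)) BV (ci.pV + 1)
  let JU : Array Dyad := Array.ofFn fun c : Fin n => IntervalD.mag (IntervalD.aget (IntervalD.lget UV (ci.pV + 1)) c)
  -- (M) over the hull
  let hp1 := IntervalD.powR ci.prec (IntervalD.ofDyad ci.h) (ci.pV + 1)
  let S : Array IntervalD := Array.ofFn fun c : Fin n => IntervalD.mulR ci.prec (IntervalD.ofDyad (dget JU c)) hp1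
  let M := T.stepMatrixMF ci.coefB ci.prec ci.H2 ci.pV (IntervalD.ofDyad ci.h) S ci.ωinvB
  { ok := okE && okK && okV
    lo := Array.ofFn fun c : Fin n => (IntervalD.aget B c).lo
    hi := Array.ofFn fun c : Fin n => (IntervalD.aget B c).hi
    loK := Array.ofFn fun c : Fin n => Dyad.neg (dget hK c)
    hiK := hK
    loV := Array.ofFn fun c : Fin n => Dyad.neg (dget hV c)
    hiV := hV
    J := J, JU := JU, M := M, L1 := ci.L1 }

end CertTables

end Summit.NavierStokesRegularity.NavierStokesRegularity.Theorems.TaylorModelCert
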